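import Mathlib
import HarnessLib
import Summits.Parity.GeneralizedHardyLittlewood.Theorems.LiouvilleShiftedTablesEngineToPairsTIIOfX1Part2
import Summits.Parity.GeneralizedHardyLittlewood.Theorems.LiouvilleShiftedTablesEngineToPairsTIIOfX1Part3

/-!
# `stub_TII_of_X1`, part 4: `(1+η)`-boxes and the separation of `x/2 < mn ≤ x` (line `Sketch`)

Fourth file of the Type-II leaf.  The `m`-range `((x/2)^{δ/2}, X]` is cut into the `(1+η)`-adic blocks
`(X/(1+η)^{i+1}, X/(1+η)^i]` of `BFI.sum_Icc_floor_eq_sum_geomBlocks`; for `m` in block `i` (scale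
`A_i = X/(1+η)^{i+1}`) the rectangle `{n : x/(2A_i) < n ≤ x/((1+η)A_i)}` lies inside the hyperbolic
region `{x/2 < mn ≤ x}` and the rest of that region has `mn` in the two BANDS
`(x/2, (1+η)x/2] ∪ (x/(1+η), x]` (`hyperbolic_decomp`).  On each rectangle the family bound of part 2
applies at scale `A_i` — window parameter `2δ/5` if `A_i ≤ x^{1/3+2δ/5}`, else `δ` — with the
divisor-sum bound for the `n`-coefficients (`rect_term_le`).
-/

noncomputable section

namespace Summit.Parity.GeneralizedHardyLittlewood.Theorems.EngineToPairs

namespace TIIOfX1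

open Finset Real
open scoped ArithmeticFunction.sigma

/-! ### Box geometry -/

/-- Consecutive scales differ by the factor `1 + η`. [folklore] -/
theorem scale_succ (X : ℝ) {η : ℝ} (hη : 0 ≤ η) (i : ℕ) :
    X / (1 + η) ^ i = (1 + η) * (X / (1 + η) ^ (i + 1)) := by
  have : (0 : ℝ) < 1 + η := by linarith
  rw [pow_succ]
  field_simp

/-- Membership in block `i` of the `m`-range: `X/(1+η)^{i+1} < m ≤ X/(1+η)^i` and `Mlow < m`.
[folklore] -/
theorem mem_box {X η Mlow : ℝ} (hX : 0 ≤ X) (hη : 0 ≤ η) {i m : ℕ}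
    (hm : m ∈ (Ioc ⌊X / (1 + η) ^ (i + 1)⌋₊ ⌊X / (1 + η) ^ i⌋₊).filter (fun m : ℕ => Mlow < m)) :
    X / (1 + η) ^ (i + 1) < m ∧ (m : ℝ) ≤ X / (1 + η) ^ i ∧ Mlow < m := by
  rw [Finset.mem_filter, Finset.mem_Ioc] at hm
  obtain ⟨⟨h1, h2⟩, h3⟩ := hm
  exact ⟨Nat.lt_of_floor_lt h1, (Nat.le_floor_iff (by positivity)).1 h2, h3⟩

/-- Block `i` lies in the rows `(⌊A_i⌋, ⌊2A_i⌋]` of X1 at scale `A_i = X/(1+η)^{i+1}` (`η ≤ 1`).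
[this line] -/
theorem box_subset_rows {X η : ℝ} (Mlow : ℝ) (hX : 0 ≤ X) (hη : 0 ≤ η) (hη1 : η ≤ 1) (i : ℕ) :
    (Ioc ⌊X / (1 + η) ^ (i + 1)⌋₊ ⌊X / (1 + η) ^ i⌋₊).filter (fun m : ℕ => Mlow < m) ⊆
      Ioc ⌊X / (1 + η) ^ (i + 1)⌋₊ ⌊2 * (X / (1 + η) ^ (i + 1))⌋₊ := by
  intro m hm
  have hm' := Finset.mem_Ioc.1 (Finset.mem_filter.1 hm).1
  refine Finset.mem_Ioc.2 ⟨hm'.1, hm'.2.trans (Nat.floor_le_floor ?_)⟩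
  rw [scale_succ X hη i]
  have : 0 ≤ X / (1 + η) ^ (i + 1) := by positivity
  nlinarith

/-- The rectangle `x/(2A) < n ≤ x/A'`, `A' = (1+η)A`, lies inside the hyperbolic region of every
`m ∈ (A, A']`. [this line] -/
theorem rect_subset_hyp {x η A A' : ℝ} (hx : 0 ≤ x) (hη : 0 ≤ η) (hA : 0 < A)
    (hA' : A' = (1 + η) * A) {m : ℕ} (hm1 : A < m) (hm2 : (m : ℝ) ≤ A') :
    (Icc 1 ⌊x⌋₊).filter (fun n : ℕ => x / (2 * A) < n ∧ (n : ℝ) ≤ x / A') ⊆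
      (Icc 1 ⌊x⌋₊).filter (fun n : ℕ => x / 2 < (m : ℝ) * n ∧ (m : ℝ) * n ≤ x) := by
  intro n hn
  rw [Finset.mem_filter] at hn ⊢
  obtain ⟨hn0, hn1, hn2⟩ := hn
  have hA'0 : 0 < A' := by rw [hA']; positivity
  refine ⟨hn0, ?_, ?_⟩
  · calc x / 2 = A * (x / (2 * A)) := by field_simp
      _ < (m : ℝ) * n := mul_lt_mul'' hm1 hn1 hA.le (by positivity)
  · calc (m : ℝ) * n ≤ A' * (x / A') := mul_le_mul hm2 hn2 (by positivity) hA'0.le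
      _ = x := by field_simp

/-- … and the rest of that hyperbolic region has `mn` in the two bands. [this line] -/
theorem sdiff_subset_band {x η A A' : ℝ} (hx : 0 ≤ x) (hη : 0 ≤ η) (hA : 0 < A)
    (hA' : A' = (1 + η) * A) {m : ℕ} (hm1 : A < m) (hm2 : (m : ℝ) ≤ A') :
    (Icc 1 ⌊x⌋₊).filter (fun n : ℕ => x / 2 < (m : ℝ) * n ∧ (m : ℝ) * n ≤ x) \
        (Icc 1 ⌊x⌋₊).filter (fun n : ℕ => x / (2 * A) < n ∧ (n : ℝ) ≤ x / A') ⊆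
      (Icc 1 ⌊x⌋₊).filter (fun n : ℕ =>
        (x / 2 < ((m * n : ℕ) : ℝ) ∧ ((m * n : ℕ) : ℝ) ≤ (1 + η) * x / 2) ∨
        (x / (1 + η) < ((m * n : ℕ) : ℝ) ∧ ((m * n : ℕ) : ℝ) ≤ x)) := by
  intro n hn
  rw [Finset.mem_sdiff, Finset.mem_filter, Finset.mem_filter] at hn
  rw [Finset.mem_filter]
  obtain ⟨⟨hn0, hlo, hhi⟩, hnot⟩ := hn
  refine ⟨hn0, ?_⟩
  push_cast
  have hA'0 : 0 < A' := by rw [hA']; positivity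
  have h1η : (0 : ℝ) < 1 + η := by linarith
  by_cases hc : x / (2 * A) < n
  · -- then `n > x/A'`, so `mn > A x / A' = x/(1+η)`
    have hc' : x / A' < n := by
      by_contra hle
      exact hnot ⟨hn0, hc, not_lt.1 hle⟩
    right
    refine ⟨?_, hhi⟩
    calc x / (1 + η) = A * (x / A') := by rw [hA']; field_simp
      _ < (m : ℝ) * n := mul_lt_mul'' hm1 hc' hA.le (by positivity)
  · -- `n ≤ x/(2A)`, so `mn ≤ A' x/(2A) = (1+η)x/2`
    left
    refine ⟨hlo, ?_⟩
    calc (m : ℝ) * n ≤ A' * (x / (2 * A)) := mul_le_mul hm2 (not_lt.1 hc) (by positivity) hA'0.le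
      _ = (1 + η) * x / 2 := by rw [hA']; field_simp

/-- The `m`-range as a union of `(1+η)`-adic blocks (BFI's subdivision). [folklore] -/
theorem sum_filter_blocks {X η : ℝ} (Mlow : ℝ) (hX : 0 ≤ X) (hη : 0 ≤ η) {M : ℕ}
    (hM : X / (1 + η) ^ M < 1) (g : ℕ → ℝ) :
    ∑ m ∈ (Icc 1 ⌊X⌋₊).filter (fun m : ℕ => Mlow < m), g m =
      ∑ i ∈ range M, ∑ m ∈ (Ioc ⌊X / (1 + η) ^ (i + 1)⌋₊ ⌊X / (1 + η) ^ i⌋₊).filter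
        (fun m : ℕ => Mlow < m), g m := by
  rw [Finset.sum_filter, Literature.NumberTheory.Sieve.BFI.sum_Icc_floor_eq_sum_geomBlocks _ hX
    (by linarith) hM]
  exact Finset.sum_congr rfl fun i _ => (Finset.sum_filter _ _).symm

/-! ### Separation of the product condition -/

/-- **Separation of `x/2 < mn ≤ x`.**  For any `Φ`, the hyperbolic double sum over
`m ∈ (Mlow, X]`, `x/2 < mn ≤ x` is bounded by the sum over the blocks `i < M` of the RECTANGULAR sums
`m ∈ block i`, `x/(2A_i) < n ≤ x/((1+η)A_i)`, plus the sum of `|Φ|` over the pairs with `mn` in the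
bands `(x/2, (1+η)x/2] ∪ (x/(1+η), x]`. [this line] -/
theorem hyperbolic_decomp {x η X Mlow : ℝ} (hx : 0 ≤ x) (hη : 0 ≤ η) (hX : 0 < X)
    {M : ℕ} (hM : X / (1 + η) ^ M < 1) (Φ : ℕ → ℕ → ℝ) :
    |∑ m ∈ (Icc 1 ⌊X⌋₊).filter (fun m : ℕ => Mlow < m),
        ∑ n ∈ (Icc 1 ⌊x⌋₊).filter (fun n : ℕ => x / 2 < (m : ℝ) * n ∧ (m : ℝ) * n ≤ x), Φ m n| ≤
      ∑ i ∈ range M,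
        |∑ m ∈ (Ioc ⌊X / (1 + η) ^ (i + 1)⌋₊ ⌊X / (1 + η) ^ i⌋₊).filter (fun m : ℕ => Mlow < m),
          ∑ n ∈ (Icc 1 ⌊x⌋₊).filter (fun n : ℕ =>
            x / (2 * (X / (1 + η) ^ (i + 1))) < n ∧ (n : ℝ) ≤ x / (X / (1 + η) ^ i)), Φ m n| +
      ∑ m ∈ (Icc 1 ⌊X⌋₊).filter (fun m : ℕ => Mlow < m),
        ∑ n ∈ (Icc 1 ⌊x⌋₊).filter (fun n : ℕ =>
          (x / 2 < ((m * n : ℕ) : ℝ) ∧ ((m * n : ℕ) : ℝ) ≤ (1 + η) * x / 2) ∨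
          (x / (1 + η) < ((m * n : ℕ) : ℝ) ∧ ((m * n : ℕ) : ℝ) ≤ x)), |Φ m n| := by
  have hpos : ∀ i : ℕ, 0 < X / (1 + η) ^ (i + 1) := fun i => by positivity
  rw [sum_filter_blocks Mlow hX.le hη hM (fun m : ℕ =>
    ∑ n ∈ (Icc 1 ⌊x⌋₊).filter (fun n : ℕ => x / 2 < (m : ℝ) * n ∧ (m : ℝ) * n ≤ x), Φ m n)]
  -- split each block's hyperbolic sum into the rectangle and the remainder
  have key : ∀ i ∈ range M,
      ∑ m ∈ (Ioc ⌊X / (1 + η) ^ (i + 1)⌋₊ ⌊X / (1 + η) ^ i⌋₊).filter (fun m : ℕ => Mlow < m),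
        ∑ n ∈ (Icc 1 ⌊x⌋₊).filter (fun n : ℕ => x / 2 < (m : ℝ) * n ∧ (m : ℝ) * n ≤ x), Φ m n =
      ∑ m ∈ (Ioc ⌊X / (1 + η) ^ (i + 1)⌋₊ ⌊X / (1 + η) ^ i⌋₊).filter (fun m : ℕ => Mlow < m),
        ∑ n ∈ (Icc 1 ⌊x⌋₊).filter (fun n : ℕ =>
            x / (2 * (X / (1 + η) ^ (i + 1))) < n ∧ (n : ℝ) ≤ x / (X / (1 + η) ^ i)), Φ m n +
      ∑ m ∈ (Ioc ⌊X / (1 + η) ^ (i + 1)⌋₊ ⌊X / (1 + η) ^ i⌋₊).filter (fun m : ℕ => Mlow < m),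
        ∑ n ∈ (Icc 1 ⌊x⌋₊).filter (fun n : ℕ => x / 2 < (m : ℝ) * n ∧ (m : ℝ) * n ≤ x) \
          (Icc 1 ⌊x⌋₊).filter (fun n : ℕ =>
            x / (2 * (X / (1 + η) ^ (i + 1))) < n ∧ (n : ℝ) ≤ x / (X / (1 + η) ^ i)), Φ m n := by
    intro i _
    rw [← sum_add_distrib]
    refine sum_congr rfl fun m hm => ?_
    obtain ⟨hm1, hm2, -⟩ := mem_box hX.le hη hm
    rw [← Finset.sum_sdiff (rect_subset_hyp hx hη (hpos i) (scale_succ X hη i) hm1 hm2), add_comm]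
  rw [sum_congr rfl key, sum_add_distrib]
  refine (abs_add_le _ _).trans (add_le_add (abs_sum_le_sum_abs _ _) ?_)
  refine (abs_sum_le_sum_abs _ _).trans ?_
  rw [sum_filter_blocks Mlow hX.le hη hM (fun m : ℕ => ∑ n ∈ (Icc 1 ⌊x⌋₊).filter (fun n : ℕ =>
          (x / 2 < ((m * n : ℕ) : ℝ) ∧ ((m * n : ℕ) : ℝ) ≤ (1 + η) * x / 2) ∨
          (x / (1 + η) < ((m * n : ℕ) : ℝ) ∧ ((m * n : ℕ) : ℝ) ≤ x)), |Φ m n|)]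
  refine sum_le_sum fun i _ => (abs_sum_le_sum_abs _ _).trans (sum_le_sum fun m hm => ?_)
  obtain ⟨hm1, hm2, -⟩ := mem_box hX.le hη hm
  refine (abs_sum_le_sum_abs _ _).trans ?_
  exact sum_le_sum_of_subset_of_nonneg
    (sdiff_subset_band hx hη (hpos i) (scale_succ X hη i) hm1 hm2) (fun _ _ _ => abs_nonneg _)

/-! ### One rectangle: the family bound of part 2 at scale `A_i` -/

/-- **A rectangle term.**  Let `RectBound δ₁` denote the conclusion of `typeII_rect_family` at the
current `x` (window parameter `δ₁`, saving `K`).  If `x ≥ 1`, `0 ≤ ε₁ ≤ δ/5`, `0 < η ≤ 1`,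
`2X ≤ x`, `X ≤ x^{1/3+δ}`, `x^{2δ/5} ≤ Mlow/2`, `1 ≤ x^{2δ/5}` and the `n`-coefficients are `τ^B`-bounded,
then for block `i` with scale `A_i = X/(1+η)^{i+1}`:
`∑_{q ∈ moduliH h (x^ε₁)} |∑_{m ∈ block i} ∑_{n ∈ rect i} ξ_m κ_n shiftWeight h q (mn)|
  ≤ ‖ξ|_{block i}‖ · √(c₁ x (log x)^{2^{2B+1}} / ((1+η)A_i)) · (1 + log x) √x (log x)^{−K}`. [this line] -/
theorem rect_term_le {h B : ℕ} {x δ ε₁ η X Mlow K c₁ : ℝ} (hx1 : 1 ≤ x) (hδ : 0 < δ) (hδ1 : δ ≤ 1 / 2)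
    (hε₁ : 0 ≤ ε₁) (hε₁' : ε₁ ≤ δ / 5) (hη : 0 < η) (hη1 : η ≤ 1) (hX0 : 0 < X) (h2X : 2 * X ≤ x)
    (hXle : X ≤ x ^ (1 / 3 + δ)) (hMlow : x ^ (2 * δ / 5) ≤ Mlow / 2) (hone : 1 ≤ x ^ (2 * δ / 5))
    (hR1 : ∀ A : ℝ, x ^ (2 * δ / 5) ≤ A → A ≤ x ^ (1 / 3 + 2 * δ / 5) →
      ∀ Q : ℝ, 1 ≤ Q → Q ≤ x ^ (2 * δ / 5 / 2) →
      ∀ Ra Cb : Finset ℕ, Ra ⊆ Ioc ⌊A⌋₊ ⌊2 * A⌋₊ → Cb ⊆ Icc 1 ⌊x / A⌋₊ → ∀ α β : ℕ → ℝ,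
        ∑ q ∈ moduliH h Q, |∑ a ∈ Ra, ∑ b ∈ Cb, α a * β b * shiftWeight h q (a * b)| ≤
          Real.sqrt (∑ a ∈ Ra, α a ^ 2) * Real.sqrt (∑ b ∈ Cb, β b ^ 2) *
            ((1 + Real.log x) * x ^ (1 / 2 : ℝ) / Real.log x ^ K))
    (hR2 : ∀ A : ℝ, x ^ δ ≤ A → A ≤ x ^ (1 / 3 + δ) →
      ∀ Q : ℝ, 1 ≤ Q → Q ≤ x ^ (δ / 2) →
      ∀ Ra Cb : Finset ℕ, Ra ⊆ Ioc ⌊A⌋₊ ⌊2 * A⌋₊ → Cb ⊆ Icc 1 ⌊x / A⌋₊ → ∀ α β : ℕ → ℝ,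
        ∑ q ∈ moduliH h Q, |∑ a ∈ Ra, ∑ b ∈ Cb, α a * β b * shiftWeight h q (a * b)| ≤
          Real.sqrt (∑ a ∈ Ra, α a ^ 2) * Real.sqrt (∑ b ∈ Cb, β b ^ 2) *
            ((1 + Real.log x) * x ^ (1 / 2 : ℝ) / Real.log x ^ K))
    (hτ : ∀ y : ℝ, 2 ≤ y →
      ∑ n ∈ Icc 1 ⌊y⌋₊, ((σ 0 n : ℕ) : ℝ) ^ (2 * B) ≤ c₁ * y * Real.log y ^ (2 ^ (2 * B + 1)))
    (ξ κ : ℕ → ℝ) (hκ : ∀ n, |κ n| ≤ tauPow B n) (i : ℕ) :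
    ∑ q ∈ moduliH h (x ^ ε₁),
        |∑ m ∈ (Ioc ⌊X / (1 + η) ^ (i + 1)⌋₊ ⌊X / (1 + η) ^ i⌋₊).filter (fun m : ℕ => Mlow < m),
          ∑ n ∈ (Icc 1 ⌊x⌋₊).filter (fun n : ℕ =>
            x / (2 * (X / (1 + η) ^ (i + 1))) < n ∧ (n : ℝ) ≤ x / (X / (1 + η) ^ i)),
            ξ m * κ n * shiftWeight h q (m * n)| ≤
      Real.sqrt (∑ m ∈ (Ioc ⌊X / (1 + η) ^ (i + 1)⌋₊ ⌊X / (1 + η) ^ i⌋₊).filter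
          (fun m : ℕ => Mlow < m), ξ m ^ 2) *
        Real.sqrt (c₁ * x * Real.log x ^ (2 ^ (2 * B + 1)) / (X / (1 + η) ^ i)) *
        ((1 + Real.log x) * x ^ (1 / 2 : ℝ) / Real.log x ^ K) := by
  have hx0 : 0 < x := by linarith
  have hL0 : 0 ≤ Real.log x := Real.log_nonneg hx1
  set A : ℝ := X / (1 + η) ^ (i + 1) with hA
  set A' : ℝ := X / (1 + η) ^ i with hA'
  have hApos : 0 < A := by positivity
  have hA'A : A' = (1 + η) * A := scale_succ X hη.le i
  have hA'pos : 0 < A' := by positivity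
  have hA'X : A' ≤ X := by
    rw [hA']
    exact div_le_self hX0.le (one_le_pow₀ (by linarith))
  set box : Finset ℕ := (Ioc ⌊A⌋₊ ⌊A'⌋₊).filter (fun m : ℕ => Mlow < m) with hbox
  set rect : Finset ℕ := (Icc 1 ⌊x⌋₊).filter (fun n : ℕ => x / (2 * A) < n ∧ (n : ℝ) ≤ x / A')
    with hrect
  -- the right-hand side is nonnegative
  have hRHS : 0 ≤ Real.sqrt (∑ m ∈ box, ξ m ^ 2) *
      Real.sqrt (c₁ * x * Real.log x ^ (2 ^ (2 * B + 1)) / A') *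
      ((1 + Real.log x) * x ^ (1 / 2 : ℝ) / Real.log x ^ K) := by positivity
  -- empty block: nothing to prove
  rcases box.eq_empty_or_nonempty with hempty | ⟨m₀, hm₀⟩
  · rw [hempty]
    simp only [sum_empty, abs_zero, sum_const_zero]
    positivity
  -- a nonempty block pins the scale `A` into the X1 windows
  obtain ⟨hm1, hm2, hm3⟩ := mem_box (le_of_lt hX0) hη.le hm₀
  have hAlow : x ^ (2 * δ / 5) ≤ A := by
    have : Mlow < (1 + η) * A := by rw [← hA'A]; linarith
    nlinarith
  have hAup : A ≤ x ^ (1 / 3 + δ) := by linarith [hA'X]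
  have hA1 : 1 ≤ A := hone.trans hAlow
  -- the sub-box conditions
  have hRa : box ⊆ Ioc ⌊A⌋₊ ⌊2 * A⌋₊ := box_subset_rows Mlow hX0.le hη.le hη1 i
  have hCb : rect ⊆ Icc 1 ⌊x / A⌋₊ := by
    intro n hn
    rw [hrect, Finset.mem_filter, Finset.mem_Icc] at hn
    refine Finset.mem_Icc.2 ⟨hn.1.1, Nat.le_floor (hn.2.2.trans ?_)⟩
    exact div_le_div_of_nonneg_left hx0.le hApos (by rw [hA'A]; nlinarith)
  have hQ1 : (1 : ℝ) ≤ x ^ ε₁ := Real.one_le_rpow hx1 hε₁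
  -- the family bound, in either window
  have hfam : ∑ q ∈ moduliH h (x ^ ε₁),
      |∑ m ∈ box, ∑ n ∈ rect, ξ m * κ n * shiftWeight h q (m * n)| ≤
        Real.sqrt (∑ m ∈ box, ξ m ^ 2) * Real.sqrt (∑ n ∈ rect, κ n ^ 2) *
          ((1 + Real.log x) * x ^ (1 / 2 : ℝ) / Real.log x ^ K) := by
    by_cases hcase : A ≤ x ^ (1 / 3 + 2 * δ / 5)
    · refine hR1 A hAlow hcase (x ^ ε₁) hQ1 ?_ box rect hRa hCb ξ κ
      exact Real.rpow_le_rpow_of_exponent_le hx1 (by linarith)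
    · have hcase' : x ^ (1 / 3 + 2 * δ / 5) < A := not_le.mp hcase
      have hAδ : x ^ δ ≤ A := by
        refine le_trans ?_ hcase'.le
        exact Real.rpow_le_rpow_of_exponent_le hx1 (by linarith)
      refine hR2 A hAδ hAup (x ^ ε₁) hQ1 ?_ box rect hRa hCb ξ κ
      exact Real.rpow_le_rpow_of_exponent_le hx1 (by linarith)
  refine hfam.trans ?_
  -- the `n`-coefficients: `∑_{rect} κ² ≤ ∑_{n ≤ x/A'} τ^{2B} ≤ c₁ (x/A') (log x)^{e₁}`
  have hxA' : 2 ≤ x / A' := by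
    rw [le_div_iff₀ hA'pos]
    linarith
  have hxA'x : x / A' ≤ x := by
    refine div_le_self hx0.le ?_
    rw [hA'A]
    nlinarith
  have hrect_sub : rect ⊆ Icc 1 ⌊x / A'⌋₊ := by
    intro n hn
    rw [hrect, Finset.mem_filter, Finset.mem_Icc] at hn
    exact Finset.mem_Icc.2 ⟨hn.1.1, Nat.le_floor hn.2.2⟩
  have hκ2 : ∑ n ∈ rect, κ n ^ 2 ≤ c₁ * (x / A') * Real.log x ^ (2 ^ (2 * B + 1)) := by
    refine (sum_sq_le_sum_sigma hκ hrect_sub).trans ((hτ _ hxA').trans ?_)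
    have hc₁ : 0 ≤ c₁ * (x / A') := by
      -- `c₁ ≥ 0` is forced by `hτ` at `y = 2`
      have h2 := hτ 2 le_rfl
      have hs : 0 ≤ ∑ n ∈ Icc 1 ⌊(2 : ℝ)⌋₊, ((σ 0 n : ℕ) : ℝ) ^ (2 * B) :=
        sum_nonneg fun _ _ => by positivity
      have hl : 0 < Real.log 2 ^ (2 ^ (2 * B + 1)) := pow_pos (Real.log_pos (by norm_num)) _
      have : 0 ≤ c₁ := by nlinarith
      positivity
    refine mul_le_mul_of_nonneg_left ?_ hc₁
    exact pow_le_pow_left₀ (Real.log_nonneg (by linarith)) (Real.log_le_log (by linarith) hxA'x) _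
  have hs : Real.sqrt (∑ n ∈ rect, κ n ^ 2) ≤
      Real.sqrt (c₁ * x * Real.log x ^ (2 ^ (2 * B + 1)) / A') := by
    refine Real.sqrt_le_sqrt (hκ2.trans_eq ?_)
    ring
  have hG : 0 ≤ (1 + Real.log x) * x ^ (1 / 2 : ℝ) / Real.log x ^ K := by positivity
  exact mul_le_mul_of_nonneg_right (mul_le_mul_of_nonneg_left hs (Real.sqrt_nonneg _)) hG

end TIIOfX1

/-- Anchor of part 4 of `stub_TII_of_X1`: the divisor weight dominates `1` on positive integers, in the
form used for the band coefficients. [this line] -/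
theorem tiiOfX1_part4_anchor : ∀ B m n : ℕ, m ≠ 0 → n ≠ 0 → 1 ≤ tauPow B m * tauPow B n :=
  fun B _ _ hm hn => one_le_mul_of_one_le_of_one_le (TIIOfX1.one_le_tauPow B hm)
    (TIIOfX1.one_le_tauPow B hn)

end Summit.Parity.GeneralizedHardyLittlewood.Theorems.EngineToPairs

end
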